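import Literature.NumberTheory.GelbartRogawski1991.DoubledWeilRepresentationUniqueness
import Literature.NumberTheory.Automorphic.Liu2021.Def411WeilCarriersDoubling
import Literature.NumberTheory.Weil1964.AdelicMetaplecticSeesawConjugate
import Literature.NumberTheory.GelbartRogawski1991.FiniteAdelicUnitaryUndoubling
import HarnessLib

/-!
# Siegel detection of characters of the doubled unitary group WITHOUT continuity, and the smooth-vector supplies
# ([GelbartRogawski1991] §3.1 Prop. 3.1.1; [Kudla1994] §3 Thm. 3.1)

Topic `NumberTheory/GelbartRogawski1991`; namespace `Literature.NumberTheory.GelbartRogawski1991.GRConstruction`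
(sequel of `DoubledWeilRepresentationUniqueness.lean`, setting of `DoubledUnitaryGlobalSplittingData`: CM field `L`,
`L⁺ = Fp L`, diagonal hermitian data `dV`, `dW`, the doubled group `H = U(J^𝔻)`, `HA = H(𝔸_{L⁺})`, the adelic
metaplectic group `MpD = Mp(𝕎_𝔻)`, the Siegel parabolic `P_Δ` = `IsSiegelDelta`, the predicate `IsDoubledWeilRep χ sD`).
THEOREMS ONLY; no definition, no named fact, no instance, no `sorry`.

The uniqueness theorem ★ `isDoubledWeilRep_unique` kills the twist `η = sD₁ / sD₂` of two `χ`-normalised splittings through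
★ `siegelDetectsCharacters`, which wants `Continuous η`.  This file removes the continuity input:
* §1 **`eq_one_of_isSiegelDelta_of_nhds_one`** — a character `η : H(𝔸) →* ℂˣ` trivial on `P_Δ(𝔸)` AND trivial on some
  neighbourhood of `1` in `H(𝔸_f)` is trivial (archimedean part by ★ `archSiegelDetects`, every place inclusion by
  ★ `localSiegelDetects`, finitely supported elements by ★ `truncPlaces_mem_finSupp`, the cofinite tail
  `cotruncPlaces S g → 1` by ★ `tendsto_cotruncPlaces`);
* §2 **`twist_eq_one_nhds_one_of_isLocallyConstant`** (generic topological group `G`) — if `s₁ = s₂ ⊗ η` and for ONE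
  vector `Φ₀ ≠ 0` both orbit maps `g ↦ ω(sᵢ g) Φ₀` are locally constant as VECTOR-valued maps, then `η = 1` near `1`;
* §3 the supplies (over ★ `assemble_finAdelicToAdelic` of `FiniteAdelicUnitaryUndoubling`): `isDoubledWeilRep_assemble_of_halves`,
  and **`isLocallyConstant_omega_finAdelic_of_isDoubledWeilRep`** — every `χ`-normalised `sD` is SMOOTH on `H(𝔸_f)`
  (★ uniqueness ⇒ `sD = assemble` of its halves ⇒ ★ `isLocallyConstant_omega_finSplitting`).
Consumer: the `hcont`-free χ-rigidity of `sD` under a doubled isometry (`DoubledWeilRepresentationIsometryTransport.lean`).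
HC_CM is proved only modulo the 7 printed citations until rung 0 closes; nothing of [Liu2021] is asserted here.

References: [GelbartRogawski1991] S. Gelbart, J. Rogawski, Invent. Math. 105 (1991), §3.1 Prop. 3.1.1 p. 455, Remark
p. 457 L9–13.  [Kudla1994] S. Kudla, Israel J. Math. 87 (1994), §3 Thm. 3.1.  [HarrisKudlaSweet1996] J. Amer. Math. Soc. 9
(1996), §1 (1.9)–(1.16).  [MoeglinVignerasWaldspurger1987] LNM 1291, Chap. 2 II.1, II.8.  [CasselsFrohlichANT1967] Ch. VII
§4.3.  [BorelJacquet1979] PSPM 33.1, §4.1.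
-/

set_option autoImplicit false

noncomputable section

open scoped Classical
open scoped Matrix
open NumberField IsDedekindDomain
open Literature.RepresentationTheory.HeisenbergGroup
open Literature.NumberTheory.Automorphic
open Literature.NumberTheory.Weil1964
open Literature.NumberTheory.GaloisRepresentations
open Literature.RepresentationTheory.HarrisKudlaSweet1996

namespace Literature.NumberTheory.GelbartRogawski1991.GRConstruction

open UnitaryDualPair
open Literature.NumberTheory.Automorphic.UnitaryGroup (symplecticGroupCongr)
open Literature.NumberTheory.Automorphic.Liu2021.Def411WeilCarriersDoubling

variable (L : Type) [Field L] [NumberField L] [IsCMField L]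
  {N M n : ℕ} (e : Fin N × Fin M ≃ Fin n)
  (dV : Fin N → L) (hdV : ∀ i, IsCMField.complexConj L (dV i) = dV i) (hdV0 : ∀ i, dV i ≠ 0)
  (dV' : Fin N → L) (hdV' : ∀ i, IsCMField.complexConj L (dV' i) = dV' i) (hdV'0 : ∀ i, dV' i ≠ 0)
  (dW : Fin M → L) (hdW : ∀ i, IsCMField.complexConj L (dW i) = dW i) (hdW0 : ∀ i, dW i ≠ 0)

open DoubledWeilUniqueness

/-! ## §1 (iv) Siegel detection of characters WITHOUT continuity: open kernel at the finite places suffices -/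

include hdV0 hdW0 in
/-- **Siegel detection, `hcont`-free form.**  A character `η` of `H(𝔸)` that is trivial on the Siegel parabolic `P_Δ(𝔸)`
and trivial on a neighbourhood of `1` of `H(𝔸_f)` is trivial: archimedean part by ★ `archSiegelDetects`, every place
inclusion by ★ `localSiegelDetects`, finitely supported elements by ★ `truncPlaces_mem_finSupp`, and the cofinite tail
`cotruncPlaces S g → 1` (★ `tendsto_cotruncPlaces`) lands in the neighbourhood.
[cite: Kudla1994, §3 Thm. 3.1] [cite: CasselsFrohlichANT1967, Ch. VII §4.3 (PDF p. 210)] [cite: BorelJacquet1979, §4.1] -/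
theorem eq_one_of_isSiegelDelta_of_nhds_one (η : HA L e dV hdV dW hdW →* ℂˣ)
    (hP : ∀ p, IsSiegelDelta L e dV hdV dW hdW p → η p = 1)
    (hU : ∃ U : Set ((UnitaryGroup.finAdelic (Fp L) L (IsCMField.complexConj L) (n + n) (hermD L e dV hdV dW hdW))), U ∈ nhds (1 : (UnitaryGroup.finAdelic (Fp L) L (IsCMField.complexConj L) (n + n) (hermD L e dV hdV dW hdW))) ∧ ∀ k ∈ U, η ((UnitaryGroup.finAdelicToAdelic (Fp L) L (IsCMField.complexConj L) (n + n) (hermD L e dV hdV dW hdW)) k) = 1) :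
    η = 1 := by
  -- the archimedean factor (abstract character: no continuity asked)
  have hA : η.comp (UnitaryGroup.archToAdelic (Fp L) L (IsCMField.complexConj L) (n + n) (hermD L e dV hdV dW hdW)) = 1 :=
    archSiegelDetects L e dV hdV hdV0 dW hdW hdW0 _ fun a ha => hP _ ha
  -- each finite place (abstract character)
  have hv : ∀ v, η.comp (locToAdelic L e dV hdV dW hdW v) = 1 := fun v =>
    localSiegelDetects L e dV hdV hdV0 dW hdW hdW0 v _ fun u hu => hP _ hu
  -- the finitely supported elements
  have hsupp : UnitaryGroup.finSupp (Fp L) L (IsCMField.complexConj L) (n + n) (hermD L e dV hdV dW hdW) ≤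
      (η.comp ((UnitaryGroup.finAdelicToAdelic (Fp L) L (IsCMField.complexConj L) (n + n) (hermD L e dV hdV dW hdW)))).ker := by
    rw [← UnitaryGroup.closure_iUnion_range_inclPlace, Subgroup.closure_le]
    intro g hg
    obtain ⟨v, hgv⟩ := Set.mem_iUnion.mp hg
    obtain ⟨u, rfl⟩ := hgv
    exact (MonoidHom.mem_ker).mpr (DFunLike.congr_fun (hv v) u)
  -- the whole finite-adelic factor: `b = truncPlaces S b · cotruncPlaces S b` with the tail in the neighbourhood
  obtain ⟨U, hU1, hUη⟩ := hU
  have hθ : ∀ b, η ((UnitaryGroup.finAdelicToAdelic (Fp L) L (IsCMField.complexConj L) (n + n) (hermD L e dV hdV dW hdW)) b) = 1 := fun b => by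
    have hev : ∀ᶠ S in Filter.atTop,
        UnitaryGroup.cotruncPlaces (Fp L) L (IsCMField.complexConj L) (n + n) (hermD L e dV hdV dW hdW) S b ∈ U :=
      (UnitaryGroup.tendsto_cotruncPlaces (Fp L) L (IsCMField.complexConj L) (n + n) (hermD L e dV hdV dW hdW) b).eventually_mem hU1
    obtain ⟨S, hS⟩ := hev.exists
    have hfac := UnitaryGroup.truncPlaces_mul_cotruncPlaces (Fp L) L (IsCMField.complexConj L) (n + n)
      (hermD L e dV hdV dW hdW) S b
    have h1 : (η.comp ((UnitaryGroup.finAdelicToAdelic (Fp L) L (IsCMField.complexConj L) (n + n) (hermD L e dV hdV dW hdW))))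
        (UnitaryGroup.truncPlaces (Fp L) L (IsCMField.complexConj L) (n + n) (hermD L e dV hdV dW hdW) S b) = 1 :=
      (MonoidHom.mem_ker).mp (hsupp (UnitaryGroup.truncPlaces_mem_finSupp (Fp L) L (IsCMField.complexConj L) (n + n)
        (hermD L e dV hdV dW hdW) S b))
    have h2 : (η.comp ((UnitaryGroup.finAdelicToAdelic (Fp L) L (IsCMField.complexConj L) (n + n) (hermD L e dV hdV dW hdW))))
        (UnitaryGroup.cotruncPlaces (Fp L) L (IsCMField.complexConj L) (n + n) (hermD L e dV hdV dW hdW) S b) = 1 := hUη _ hS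
    have h3 : η ((UnitaryGroup.finAdelicToAdelic (Fp L) L (IsCMField.complexConj L) (n + n) (hermD L e dV hdV dW hdW)) b) = (η.comp ((UnitaryGroup.finAdelicToAdelic (Fp L) L (IsCMField.complexConj L) (n + n) (hermD L e dV hdV dW hdW))))
        (UnitaryGroup.truncPlaces (Fp L) L (IsCMField.complexConj L) (n + n) (hermD L e dV hdV dW hdW) S b *
          UnitaryGroup.cotruncPlaces (Fp L) L (IsCMField.complexConj L) (n + n) (hermD L e dV hdV dW hdW) S b) :=
      congrArg (fun x => η ((UnitaryGroup.finAdelicToAdelic (Fp L) L (IsCMField.complexConj L) (n + n) (hermD L e dV hdV dW hdW)) x)) hfac.symm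
    exact h3.trans (((η.comp ((UnitaryGroup.finAdelicToAdelic (Fp L) L (IsCMField.complexConj L) (n + n) (hermD L e dV hdV dW hdW)))).map_mul _ _).trans (by rw [h1, h2, one_mul]))
  -- assemble `g = (g_∞, 1) · (1, g_f)`
  refine MonoidHom.ext fun g => ?_
  have hg : (UnitaryGroup.archToAdelic (Fp L) L (IsCMField.complexConj L) (n + n) (hermD L e dV hdV dW hdW)
        (UnitaryGroup.archPart (Fp L) L (IsCMField.complexConj L) (n + n) (hermD L e dV hdV dW hdW) g) : HA L e dV hdV dW hdW) *
      ((UnitaryGroup.finAdelicToAdelic (Fp L) L (IsCMField.complexConj L) (n + n) (hermD L e dV hdV dW hdW))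
        (UnitaryGroup.finPart (Fp L) L (IsCMField.complexConj L) (n + n) (hermD L e dV hdV dW hdW) g) : HA L e dV hdV dW hdW) = g :=
    UnitaryGroup.archToAdelic_mul_finAdelicToAdelic (Fp L) L (IsCMField.complexConj L) (n + n) (hermD L e dV hdV dW hdW) g
  have h1 : η (UnitaryGroup.archToAdelic (Fp L) L (IsCMField.complexConj L) (n + n) (hermD L e dV hdV dW hdW)
      (UnitaryGroup.archPart (Fp L) L (IsCMField.complexConj L) (n + n) (hermD L e dV hdV dW hdW) g)) = 1 :=
    DFunLike.congr_fun hA _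
  have h2 := hθ (UnitaryGroup.finPart (Fp L) L (IsCMField.complexConj L) (n + n) (hermD L e dV hdV dW hdW) g)
  exact (congrArg η hg.symm).trans ((map_mul η _ _).trans ((congrArg₂ (· * ·) h1 h2).trans (one_mul 1)))

/-! ## §2 (iii′) the twist is `1` near `1` from LOCALLY CONSTANT orbit maps of one non-zero vector -/

omit [IsCMField L] in
/-- **open stabiliser of the twist.**  `s₁ = s₂ ⊗ η` on a topological group `G`; if for ONE vector `Φ₀ ≠ 0` both orbit maps
`g ↦ ω(sᵢ g) Φ₀` are locally constant (as VECTOR-valued maps), then `η = 1` on a neighbourhood of `1`.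
[cite: GelbartRogawski1991, §3.1 Remark p. 457 L9–13] [cite: MoeglinVignerasWaldspurger1987, Chap. 2 II.8] -/
theorem twist_eq_one_nhds_one_of_isLocallyConstant {G : Type*} [Group G] [TopologicalSpace G]
    {T : Matrix (Fin (n + n)) (Fin (n + n)) (AdeleRing (𝓞 (Fp L)) (Fp L))}
    {s₁ s₂ : G →* adelicMpCont (Fp L) (Fin (n + n)) T} {η : G →* ℂˣ}
    (hη : s₁ = adelicMpCont.twist (Fp L) (Fin (n + n)) T s₂ η)
    (Φ₀ : piSchwartzBruhat (Fp L) (Fin (n + n))) (hΦ₀ : Φ₀ ≠ 0)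
    (h₁ : IsLocallyConstant fun g => adelicMpCont.omega (Fp L) (Fin (n + n)) T (s₁ g) Φ₀)
    (h₂ : IsLocallyConstant fun g => adelicMpCont.omega (Fp L) (Fin (n + n)) T (s₂ g) Φ₀) :
    ∃ U : Set G, U ∈ nhds (1 : G) ∧ ∀ g ∈ U, η g = 1 := by
  have hω1 : ∀ s : G →* adelicMpCont (Fp L) (Fin (n + n)) T, adelicMpCont.omega (Fp L) (Fin (n + n)) T (s 1) Φ₀ = Φ₀ :=
    fun s => (congrArg (fun q => adelicMpCont.omega (Fp L) (Fin (n + n)) T q Φ₀) (map_one s)).trans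
      (by simpa only [Module.End.one_apply] using LinearMap.congr_fun (map_one (adelicMpCont.omega (Fp L) (Fin (n + n)) T)) Φ₀)
  refine ⟨{g | adelicMpCont.omega (Fp L) (Fin (n + n)) T (s₁ g) Φ₀ = Φ₀} ∩
      {g | adelicMpCont.omega (Fp L) (Fin (n + n)) T (s₂ g) Φ₀ = Φ₀},
    Filter.inter_mem ((h₁.isOpen_fiber Φ₀).mem_nhds (hω1 s₁)) ((h₂.isOpen_fiber Φ₀).mem_nhds (hω1 s₂)), fun g hg => ?_⟩
  have e₁ : adelicMpCont.omega (Fp L) (Fin (n + n)) T (s₁ g) Φ₀ = Φ₀ := hg.1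
  have e₂ : adelicMpCont.omega (Fp L) (Fin (n + n)) T (s₂ g) Φ₀ = Φ₀ := hg.2
  -- `s₁ g = (1, η g) · s₂ g`, read on `Φ₀` (term-mode chain, no `rw` on `Mp` terms)
  have step1 : s₁ g = adelicMpCont.ofScalar (Fp L) (Fin (n + n)) T (η g) * s₂ g :=
    (DFunLike.congr_fun hη g).trans (adelicMpCont.twist_apply s₂ η g)
  have step2 : adelicMpCont.omega (Fp L) (Fin (n + n)) T (s₁ g) Φ₀ =
      adelicMpCont.omega (Fp L) (Fin (n + n)) T (adelicMpCont.ofScalar (Fp L) (Fin (n + n)) T (η g))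
        (adelicMpCont.omega (Fp L) (Fin (n + n)) T (s₂ g) Φ₀) :=
    (congrArg (fun q => adelicMpCont.omega (Fp L) (Fin (n + n)) T q Φ₀) step1).trans
      (LinearMap.congr_fun (map_mul (adelicMpCont.omega (Fp L) (Fin (n + n)) T) _ _) Φ₀)
  have e₃ : adelicMpCont.omega (Fp L) (Fin (n + n)) T (s₁ g) Φ₀ = ((η g : ℂˣ) : ℂ) • Φ₀ :=
    step2.trans ((congrArg (fun Ψ => adelicMpCont.omega (Fp L) (Fin (n + n)) T
      (adelicMpCont.ofScalar (Fp L) (Fin (n + n)) T (η g)) Ψ) e₂).trans (adelicMpCont.omega_ofScalar (η g) Φ₀))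
  have e₄ : ((η g : ℂˣ) : ℂ) • Φ₀ = (1 : ℂ) • Φ₀ := e₃.symm.trans (e₁.trans (one_smul ℂ Φ₀).symm)
  exact Units.val_eq_one.mp (smul_left_injective ℂ hΦ₀ e₄)

/-! ## §3 the two local-constancy supplies -/

include hdV0 hdW0 in
/-- `assemble hf ha` is `χ`-normalised (the fields of ★ `isDoubledWeilRep_of_halves`, named). [cite: HarrisKudlaSweet1996, §1 (1.11)–(1.16)] -/
theorem isDoubledWeilRep_assemble_of_halves {χ : HeckeCharacter L}
    {sf : (UnitaryGroup.finAdelic (Fp L) L (IsCMField.complexConj L) (n + n) (hermD L e dV hdV dW hdW)) →* MpD L e dV hdV dW hdW}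
    {sa : UnitaryGroup.arch (Fp L) L (IsCMField.complexConj L) (n + n) (hermD L e dV hdV dW hdW) →* MpD L e dV hdV dW hdW}
    (hf : IsFinHalf L e dV hdV hdV0 dW hdW hdW0 χ sf) (ha : IsArchHalf L e dV hdV hdV0 dW hdW hdW0 χ sa) :
    IsDoubledWeilRep L e dV hdV hdV0 dW hdW hdW0 χ (assemble L e dV hdV hdV0 dW hdW hdW0 hf ha) where
  continuous := S1asm_continuous L e dV hdV hdV0 dW hdW hdW0 hf ha
  proj_eq := proj_assemble L e dV hdV hdV0 dW hdW hdW0 hf ha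
  parabolic := S1asm_parabolic L e dV hdV hdV0 dW hdW hdW0 hf ha

include hdV0 hdW0 in
set_option maxHeartbeats 4000000 in -- measured: fails at 2 000 000, passes at 2 400 000 (isDefEq in the `assemble` comparison)
/-- **every `χ`-normalised doubled Weil representation is SMOOTH on `H(𝔸_f)`**: `k ↦ ω(sD(1,k)) Φ` is locally constant
(★ `isDoubledWeilRep_unique` ⇒ `sD = assemble hf ha` with the finite half of record ★ `finHalf = finSplittings.finSplitting`;
`assemble (1,k) = sf k`; ★ `isLocallyConstant_omega_finSplitting`).
[cite: MoeglinVignerasWaldspurger1987, Chap. 2 II.8] [cite: GelbartRogawski1991, §3.1 Prop. 3.1.1 p. 455 L1–2] -/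
theorem isLocallyConstant_omega_finAdelic_of_isDoubledWeilRep (χ : HeckeCharacter L) (hχu : χ.IsUnitary)
    (hχs : IsSplittingChar L 1 χ) {sD : HA L e dV hdV dW hdW →* MpD L e dV hdV dW hdW}
    (hsD : IsDoubledWeilRep L e dV hdV hdV0 dW hdW hdW0 χ sD) (Φ : piSchwartzBruhat (Fp L) (Fin (n + n))) :
    IsLocallyConstant fun k : (UnitaryGroup.finAdelic (Fp L) L (IsCMField.complexConj L) (n + n) (hermD L e dV hdV dW hdW)) =>
      adelicMpCont.omega (Fp L) (Fin (n + n)) (gramDA L e dV hdV dW hdW) (sD ((UnitaryGroup.finAdelicToAdelic (Fp L) L (IsCMField.complexConj L) (n + n) (hermD L e dV hdV dW hdW)) k)) Φ := by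
  -- the halves of record
  obtain ⟨𝓕⟩ := nonempty_finLocalFamily L e dV hdV hdV0 dW hdW hdW0 χ hχs (haarData L)
  obtain ⟨sa, ha⟩ := exists_isArchHalf L e dV hdV hdV0 dW hdW hdW0 χ hχu hχs
  have hf := finHalf_isFinHalf L e dV hdV hdV0 dW hdW hdW0 χ (haarData L) 𝓕
  have heq : sD = assemble L e dV hdV hdV0 dW hdW hdW0 hf ha :=
    isDoubledWeilRep_unique L e dV hdV hdV0 dW hdW hdW0 χ hsD
      (isDoubledWeilRep_assemble_of_halves L e dV hdV hdV0 dW hdW hdW0 hf ha)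
  have hk : ∀ k : (UnitaryGroup.finAdelic (Fp L) L (IsCMField.complexConj L) (n + n) (hermD L e dV hdV dW hdW)), sD ((UnitaryGroup.finAdelicToAdelic (Fp L) L (IsCMField.complexConj L) (n + n) (hermD L e dV hdV dW hdW)) k) = finHalf L e dV hdV hdV0 dW hdW hdW0 χ (haarData L) 𝓕 k := fun k =>
    (DFunLike.congr_fun heq _).trans (assemble_finAdelicToAdelic L e dV hdV dW hdW hdV0 hdW0 hf ha k)
  have hfun : (fun k : (UnitaryGroup.finAdelic (Fp L) L (IsCMField.complexConj L) (n + n) (hermD L e dV hdV dW hdW)) =>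
      adelicMpCont.omega (Fp L) (Fin (n + n)) (gramDA L e dV hdV dW hdW) (sD ((UnitaryGroup.finAdelicToAdelic (Fp L) L (IsCMField.complexConj L) (n + n) (hermD L e dV hdV dW hdW)) k)) Φ) =
      fun k => adelicMpCont.omega (Fp L) (Fin (n + n)) (gramDA L e dV hdV dW hdW)
        (finHalf L e dV hdV hdV0 dW hdW hdW0 χ (haarData L) 𝓕 k) Φ :=
    funext fun k => congrArg (fun q => adelicMpCont.omega (Fp L) (Fin (n + n)) (gramDA L e dV hdV dW hdW) q Φ) (hk k)
  rw [hfun]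
  exact (finSplittings L e dV hdV hdV0 dW hdW hdW0 χ (haarData L) 𝓕).isLocallyConstant_omega_finSplitting Φ

end Literature.NumberTheory.GelbartRogawski1991.GRConstruction

end
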